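import Summits.ValiantsHypothesis.ValiantsHypothesis.Theorems.BarrierLeverAnchoredDoorHitsLowerPairsAnchorSetsClosedForm

/-!
# Support item `AnchoredDoorHitsLowerPairs` (stmt-ValiantsHypothesis-22510), line `anchored-peeling`:
# THE PROFILE-2 DOMINANT PROBLEM — pair anchors scaled by one parameter `L`; its leading term reduces `symbolicDet 2 ≠ 0` to a determinant of
# MAXIMUM-MATCHING anchor sums (`p2Entry`)

Helper file (`--supports stmt-ValiantsHypothesis-22510`; cell valiant-natproofs, rung V4, 𝒟-side door (c); registered line
`Cruxes/AnchoredDoorHitsLowerPairs/Lines/anchored_peeling.lean` v25, registered residual `Stmt.stub_ltRestNonCanonRS`; prover seat val-np-p1 gen 25;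
memo HOME/val-np-p1/g25/MEMO-weighted-apex-valnp1-g25.md §4.1/§7, kernel blueprint K1). Closes NO item.

WHAT. At profile `2` the anchored door has VERTEX anchors `(A | {c})` and PAIR anchors `(A | {c, d})` (`|A| ≤ 2`). Evaluate the symbolic witness at the
`ℂ[L]`-point `p2Point Θ Φ`: `θ_α ↦ Θ α · L^{[|B_α| = 2]}`, `φ_{α b} ↦ Φ α b`, `ψ ↦ 0` (no `y`-tails). By the anchor-set expansion of `…AnchorSets`
(`coeff_symbolicWitness_eq_sum`, closed forms `xcoeff_eq` / `ycoeff_eq`) the layout entry `[x^U y^W]` becomes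
`Σ_J Θ^J · xcE Φ U J · L^{nPairs J}` over the anchor sets `J` whose `y`-parts PARTITION `W` (`aeval_p2Point_entry`); such a `J` has at most `⌊|W|/2⌋`
pair anchors (`nPairs_le_div_two`), so the entry has `L`-degree `≤ ⌊|W|/2⌋` with top coefficient
`p2Entry Θ Φ W U = Σ_{J : y-parts a MAXIMUM MATCHING partition of W} Θ^J · xcE Φ U J` — the «dominant problem 𝒫₂» of the memo (for `|W| ≤ 3`:
vertex doors, FRESH pair doors, and `E_{cd}E_e + E_{ce}E_d + E_{de}E_c` for triangles). By the top-coefficient lemma `coeff_det_of_natDegree_le`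
(`…StarSpec`):

**THEOREM `symbolicDet_two_ne_zero_of_p2Entry`.** If `det (p2Entry Θ Φ (w j) (u i))_{i,j} ≠ 0` for some complex `Θ, Φ`, then `symbolicDet 2 h r u w ≠ 0`.

This is step K1 of the profile-2 apex recursion (memo §7): the recursion itself (K2–K3: the weighted apex move with free pair columns, level-set weights
and a row subfamily in the bottom block) operates on `p2Entry` and is the subject of the sequel files. Bookkeeping `def`s only: `p2Point`, `nPairs`, `xcE`,
`p2Entry`.

WHAT THIS IS NOT: no pair is certified here; nothing on crux stmt-ValiantsHypothesis-14610 or on `VP` versus `VNP`.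
-/

set_option linter.dupNamespace false

namespace Summit.ValiantsHypothesis.ValiantsHypothesis.Theorems.BarrierLever.AnchoredPeeling

open Finset MvPolynomial
open Summit.ValiantsHypothesis.ValiantsHypothesis.Theorems.BarrierLever.BrickCalculus (pexpo pexpo_def pexpo_le_iff pexpo_sub
  pexpo_apply_castAdd pexpo_apply_natAdd)

noncomputable section

namespace P2

variable {h : ℕ}

/-! ## 1. The profile-2 point over `ℂ[L]` and the evaluated one-sided coefficients -/

section Point

variable (Θ : Finset (Fin h) × Finset (Fin h) → ℂ) (Φ : Finset (Fin h) × Finset (Fin h) → Fin h → ℂ)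

/-- The number of PAIR anchors (`|B| = 2`) in an anchor set. -/
def nPairs (J : Finset (Finset (Fin h) × Finset (Fin h))) : ℕ := (J.filter (fun α => α.2.card = 2)).card

/-- **The profile-2 point over `ℂ[L]`:** anchor weights `Θ α`, scaled by `L` on pair anchors; `x`-tails `Φ α b`; no `y`-tails. -/
def p2Point : Param h → Polynomial ℂ
  | Sum.inl α => Polynomial.C (Θ α) * (if α.2.card = 2 then Polynomial.X else 1)
  | Sum.inr (Sum.inl q) => Polynomial.C (Φ q.1 q.2)
  | Sum.inr (Sum.inr _) => 0

open Classical in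
/-- The evaluated one-sided `x`-coefficient of an anchor set on the row `U` (closed form of `AnchorSets.xcoeff_eq` at the point). -/
def xcE (U : Finset (Fin h)) (J : Finset (Finset (Fin h) × Finset (Fin h))) : ℂ :=
  if (J : Set (Finset (Fin h) × Finset (Fin h))).PairwiseDisjoint Prod.fst ∧ AnchorSets.xFoot J ⊆ U
  then ∏ b ∈ U \ AnchorSets.xFoot J, ∑ α ∈ J, Φ α b else 0

/-- «The `y`-parts of the anchor set `J` partition `W`» (pairwise disjoint with union `W`). -/
def YPart (W : Finset (Fin h)) (J : Finset (Finset (Fin h) × Finset (Fin h))) : Prop :=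
  (↑J : Set (Finset (Fin h) × Finset (Fin h))).PairwiseDisjoint Prod.snd ∧ AnchorSets.yFoot J = W

open Classical in
/-- **The dominant (`𝒫₂`) entry** of the column `W` on the row `U`: the sum over the anchor sets whose `y`-parts partition `W` with the MAXIMUM
number `⌊|W|/2⌋` of pairs, of `Θ^J · xcE U J`. -/
def p2Entry (W U : Finset (Fin h)) : ℂ :=
  ∑ J ∈ ((anchors 2 h).powerset).filter (fun J : Finset (Finset (Fin h) × Finset (Fin h)) => YPart W J ∧ nPairs J = W.card / 2),
    (∏ α ∈ J, Θ α) * xcE Φ U J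

variable {Θ Φ}

/-- `aeval` at the point on a `θ`-variable. -/
theorem aeval_p2Point_theta (α : Finset (Fin h) × Finset (Fin h)) :
    aeval (p2Point Θ Φ) (X (Sum.inl α) : MvPolynomial (Param h) ℂ) = Polynomial.C (Θ α) * (if α.2.card = 2 then Polynomial.X else 1) := by
  rw [aeval_X]; rfl

/-- `aeval` at the point on a `φ`-variable. -/
theorem aeval_p2Point_phi (α : Finset (Fin h) × Finset (Fin h)) (b : Fin h) :
    aeval (p2Point Θ Φ) (X (Sum.inr (Sum.inl (α, b))) : MvPolynomial (Param h) ℂ) = Polynomial.C (Φ α b) := by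
  rw [aeval_X]; rfl

/-- `aeval` at the point on a `ψ`-variable is `0`. -/
theorem aeval_p2Point_psi (α : Finset (Fin h) × Finset (Fin h)) (d : Fin h) :
    aeval (p2Point Θ Φ) (X (Sum.inr (Sum.inr (α, d))) : MvPolynomial (Param h) ℂ) = 0 := by
  rw [aeval_X]; rfl

/-- **The `θ`-monomial of `J` evaluates to `Θ^J · L^{nPairs J}`.** -/
theorem aeval_thetaMon (J : Finset (Finset (Fin h) × Finset (Fin h))) :
    aeval (p2Point Θ Φ) (AnchorSets.thetaMon J) = Polynomial.C (∏ α ∈ J, Θ α) * Polynomial.X ^ nPairs J := by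
  classical
  rw [AnchorSets.thetaMon, map_prod, Finset.prod_congr rfl (fun α _ => aeval_p2Point_theta α), Finset.prod_mul_distrib, map_prod,
    Finset.prod_ite, Finset.prod_const_one, mul_one, Finset.prod_const, nPairs]

/-- **The `x`-coefficient evaluates to the constant `xcE`.** -/
theorem aeval_xcoeff (U : Finset (Fin h)) (J : Finset (Finset (Fin h) × Finset (Fin h))) :
    aeval (p2Point Θ Φ) (AnchorSets.xcoeff U J) = Polynomial.C (xcE Φ U J) := by
  classical
  rw [AnchorSets.xcoeff_eq, xcE]
  by_cases hc : (J : Set (Finset (Fin h) × Finset (Fin h))).PairwiseDisjoint Prod.fst ∧ AnchorSets.xFoot J ⊆ U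
  · rw [if_pos hc, if_pos hc, map_prod, map_prod]
    refine Finset.prod_congr rfl (fun b _ => ?_)
    rw [map_sum, map_sum]
    exact Finset.sum_congr rfl (fun α _ => aeval_p2Point_phi α b)
  · rw [if_neg hc, if_neg hc, map_zero, map_zero]

open Classical in
/-- **The `y`-coefficient evaluates to the indicator «the `y`-parts of `J` partition `W`»** (no `y`-tails at the point). -/
theorem aeval_ycoeff (W : Finset (Fin h)) (J : Finset (Finset (Fin h) × Finset (Fin h))) :
    aeval (p2Point Θ Φ) (AnchorSets.ycoeff W J) = if YPart W J then 1 else 0 := by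
  rw [AnchorSets.ycoeff_eq, YPart]
  by_cases hd : (J : Set (Finset (Fin h) × Finset (Fin h))).PairwiseDisjoint Prod.snd
  · by_cases hsub : AnchorSets.yFoot J ⊆ W
    · rw [if_pos ⟨hd, hsub⟩, map_prod]
      have hz : ∀ b ∈ W \ AnchorSets.yFoot J,
          aeval (p2Point Θ Φ) (∑ α ∈ J, (X (Sum.inr (Sum.inr (α, b))) : MvPolynomial (Param h) ℂ)) = 0 := by
        intro b _
        rw [map_sum]
        exact Finset.sum_eq_zero (fun α _ => aeval_p2Point_psi α b)
      rw [Finset.prod_congr rfl hz, Finset.prod_const]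
      by_cases heq : AnchorSets.yFoot J = W
      · rw [if_pos ⟨hd, heq⟩, heq, Finset.sdiff_self, Finset.card_empty, pow_zero]
      · rw [if_neg (fun hc => heq hc.2), zero_pow]
        intro h0
        apply heq
        exact Finset.Subset.antisymm hsub (Finset.sdiff_eq_empty_iff_subset.mp (Finset.card_eq_zero.mp h0))
    · rw [if_neg (fun hc => hsub hc.2), if_neg (fun hc => hsub hc.2.le), map_zero]
  · rw [if_neg (fun hc => hd hc.1), if_neg (fun hc => hd hc.1), map_zero]

open Classical in
/-- **The evaluated layout entry:** `Σ_{J : y-parts partition W} (Θ^J · xcE U J) · L^{nPairs J}`. -/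
theorem aeval_p2Point_entry (U W : Finset (Fin h)) :
    aeval (p2Point Θ Φ) (coeff (pexpo U W) (symbolicWitness 2 h)) =
      ∑ J ∈ ((anchors 2 h).powerset).filter (fun J : Finset (Finset (Fin h) × Finset (Fin h)) => YPart W J),
        Polynomial.C ((∏ α ∈ J, Θ α) * xcE Φ U J) * Polynomial.X ^ nPairs J := by
  rw [AnchorSets.coeff_symbolicWitness_eq_sum, map_sum, Finset.sum_filter]
  refine Finset.sum_congr rfl (fun J _ => ?_)
  rw [map_mul, map_mul, aeval_thetaMon, aeval_xcoeff, aeval_ycoeff]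
  by_cases hc : YPart W J
  · rw [if_pos hc, if_pos hc, mul_one, map_mul]; ring
  · rw [if_neg hc, if_neg hc, mul_zero, mul_zero]

end Point

/-! ## 2. Degree bound: a `y`-partition of `W` by profile-2 anchors has at most `⌊|W|/2⌋` pairs -/

/-- The `y`-footprint of a `y`-disjoint anchor set has `Σ_{α ∈ J} |B_α|` elements. -/
theorem card_yFoot_eq_sum {J : Finset (Finset (Fin h) × Finset (Fin h))}
    (hd : (J : Set (Finset (Fin h) × Finset (Fin h))).PairwiseDisjoint Prod.snd) :
    (AnchorSets.yFoot J).card = ∑ α ∈ J, α.2.card := by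
  rw [AnchorSets.yFoot, Finset.card_biUnion hd]

/-- **At most `⌊|W|/2⌋ pair anchors** in an anchor set of profile `2` whose `y`-parts partition `W`. -/
theorem nPairs_le_div_two {W : Finset (Fin h)} {J : Finset (Finset (Fin h) × Finset (Fin h))} (hJ : J ⊆ anchors 2 h)
    (hd : (J : Set (Finset (Fin h) × Finset (Fin h))).PairwiseDisjoint Prod.snd) (hfoot : AnchorSets.yFoot J = W) :
    nPairs J ≤ W.card / 2 := by
  classical
  have hsum : ∑ α ∈ J, α.2.card = W.card := by rw [← hfoot, card_yFoot_eq_sum hd]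
  -- each anchor contributes `1 + [|B| = 2]`
  have hge : ∀ α ∈ J, (1 + if α.2.card = 2 then 1 else 0) ≤ α.2.card := by
    intro α hα
    have hmem := hJ hα
    simp only [anchors, Finset.mem_filter, Finset.mem_univ, true_and] at hmem
    by_cases h2 : α.2.card = 2
    · rw [if_pos h2, h2]
    · rw [if_neg h2, add_zero]; exact hmem.2.2.1
  have hle : J.card + nPairs J ≤ W.card := by
    rw [← hsum, nPairs, Finset.card_filter, Finset.card_eq_sum_ones J, ← Finset.sum_add_distrib]
    exact Finset.sum_le_sum hge
  have hpJ : nPairs J ≤ J.card := by rw [nPairs]; exact Finset.card_filter_le _ _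
  apply (Nat.le_div_iff_mul_le (by norm_num)).mpr
  omega

/-! ## 3. The leading term of the determinant -/

section Det

variable (Θ : Finset (Fin h) × Finset (Fin h) → ℂ) (Φ : Finset (Fin h) × Finset (Fin h) → Fin h → ℂ)

open Classical in
/-- **Degree bound:** the evaluated entry of the column `W` has `L`-degree `≤ ⌊|W|/2⌋`. -/
theorem natDegree_entry_le (U W : Finset (Fin h)) :
    (aeval (p2Point Θ Φ) (coeff (pexpo U W) (symbolicWitness 2 h))).natDegree ≤ W.card / 2 := by
  classical
  rw [aeval_p2Point_entry]
  refine Polynomial.natDegree_sum_le_of_forall_le _ _ (fun J hJ => ?_)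
  obtain ⟨hJp, hd, hfoot⟩ := Finset.mem_filter.mp hJ
  exact (Polynomial.natDegree_C_mul_X_pow_le _ _).trans (nPairs_le_div_two (Finset.mem_powerset.mp hJp) hd hfoot)

open Classical in
/-- **Top coefficient:** the coefficient of `L^{⌊|W|/2⌋}` of the evaluated entry is the dominant entry `p2Entry W U`. -/
theorem coeff_entry_top (U W : Finset (Fin h)) :
    (aeval (p2Point Θ Φ) (coeff (pexpo U W) (symbolicWitness 2 h))).coeff (W.card / 2) = p2Entry Θ Φ W U := by
  rw [aeval_p2Point_entry, Polynomial.finsetSum_coeff, p2Entry, Finset.sum_filter, Finset.sum_filter]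
  refine Finset.sum_congr rfl (fun J _ => ?_)
  by_cases hy : YPart W J
  · rw [if_pos hy, Polynomial.coeff_C_mul_X_pow]
    by_cases hk : nPairs J = W.card / 2
    · rw [if_pos hk.symm, if_pos ⟨hy, hk⟩]
    · rw [if_neg (fun h' => hk h'.symm), if_neg (fun h' => hk h'.2)]
  · rw [if_neg hy, if_neg (fun h' => hy h'.1)]

/-- **THE PROFILE-2 REDUCTION.** If the dominant matrix `(p2Entry Θ Φ (w j) (u i))_{i j}` is nonsingular for some complex weights `Θ` and
`x`-tails `Φ`, then the symbolic profile-2 minor of the layout `(u, w)` is nonzero. -/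
theorem symbolicDet_two_ne_zero_of_p2Entry {r : ℕ} (u w : Fin r → Finset (Fin h))
    (hdet : (Matrix.of fun i j : Fin r => p2Entry Θ Φ (w j) (u i)).det ≠ 0) : symbolicDet 2 h r u w ≠ 0 := by
  classical
  intro h0
  -- evaluate the symbolic minor at the point
  set M : Matrix (Fin r) (Fin r) (Polynomial ℂ) :=
    Matrix.of fun i j : Fin r => aeval (p2Point Θ Φ) (coeff (pexpo (u i) (w j)) (symbolicWitness 2 h)) with hM
  have hmap : aeval (p2Point Θ Φ) (symbolicDet 2 h r u w) = M.det := by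
    rw [symbolicDet, AlgHom.map_det]
    congr 1
  have hMdet : M.det = 0 := by rw [← hmap, h0, map_zero]
  -- its coefficient at `Σ_j ⌊|w j|/2⌋` is the dominant determinant
  have htop := coeff_det_of_natDegree_le M (fun j => (w j).card / 2) (fun i j => by rw [hM, Matrix.of_apply]; exact natDegree_entry_le Θ Φ (u i) (w j))
  rw [hMdet, Polynomial.coeff_zero] at htop
  have hmat : (Matrix.of fun i j : Fin r => (M i j).coeff ((w j).card / 2)) = Matrix.of fun i j : Fin r => p2Entry Θ Φ (w j) (u i) := by
    ext i j
    rw [Matrix.of_apply, Matrix.of_apply, hM, Matrix.of_apply, coeff_entry_top]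
  exact hdet (by rw [← hmat, ← htop])

end Det

end P2

end

end Summit.ValiantsHypothesis.ValiantsHypothesis.Theorems.BarrierLever.AnchoredPeeling
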